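import Literature.MathematicalPhysics.QuantumFieldTheory.SchwartzTensorNorms
import Literature.MathematicalPhysics.QuantumFieldTheory.OSVectorNormGrowth
import HarnessLib

/-!
# Schwartz seminorms of tensor products with the total order distributed over the factors

Support file (everything proved, no definitions), a sharpening of `SchwartzTensorNorms`. There the
Schwartz norm of `⊗ⱼ fⱼ` of order `M` is bounded by `(2^{M+1})ⁿ ∏ⱼ |fⱼ|_M` — every factor is
charged with the full order `M`. For the temperedness estimate (4.5) of Osterwalder–Schrader II
(Comm. Math. Phys. 42 (1975), Thm. 4.1 / Ch. VI.1) with its exponent *linear* in the number of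
points this is too crude: the `M` derivatives of a product `∏ⱼ fⱼ(xⱼ)` are *distributed* over the
factors (OS II (6.17): "`sup |D^ν_x D^ν_y ∏ …|`" with `|ν| ≤ 2ns` in total), so that profiles of
width `ρ` contribute `ρ^{-(M + n·dim)}` and not `ρ^{-nM}`. The clean form of this bookkeeping is
geometric: **if the seminorms of the factors grow geometrically in the order with a common ratio
`B`, `p_{k,i}(fⱼ) ≤ aⱼ Rᵏ Bⁱ` (`k, i ≤ M`), then `p_{k,l}(⊗_{j<n} fⱼ) ≤ 2ⁿ (∏ aⱼ) Rᵏ (nB)ˡ`**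
(`seminorm_tensorFin_le_geometric`) — the ratio becomes `nB`, by the binomial identity
`∑ᵢ C(l,i) nⁱ = (n+1)ˡ` in the recursion `⊗_{j≤n} = (⊗_{j<n}) ⊗ fₙ`
(`SchwartzMap.seminorm_mulComp_le`); and `|⊗ⱼ fⱼ|_M ≤ 2ⁿ (∏ aⱼ) Rᴹ max(1, nB)ᴹ`
(`schwartzNorm_tensorFin_le_geometric`).

## References

* K. Osterwalder, R. Schrader, *Axioms for Euclidean Green's functions II*, Comm. Math. Phys. 42
  (1975) 281–305, Ch. VI.1 (6.12), (6.17)–(6.18). [OsterwalderSchraderCMP1975]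

Everything here is folklore.
-/

noncomputable section

open scoped SchwartzMap

namespace Literature.MathematicalPhysics.QuantumFieldTheory

open Literature.MathematicalPhysics.QuantumLattice (schwartzNorm)

variable {E : Type*} [NormedAddCommGroup E] [NormedSpace ℝ E]

/-- The binomial identity `∑ᵢ C(l,i) nⁱ = (n+1)ˡ`. [folklore] -/
theorem sum_choose_mul_pow (l : ℕ) (x : ℝ) : ∑ i ∈ Finset.range (l + 1), (l.choose i : ℝ) * x ^ i = (x + 1) ^ l := by
  rw [add_pow]
  refine Finset.sum_congr rfl fun i _ => ?_
  rw [one_pow, mul_one, mul_comm]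

/-- Seminorms of the empty tensor: `p_{k,l}(1) ≤ Rᵏ (0·B)ˡ` read with `0⁰ = 1`, for `R ≥ 1`. [folklore] -/
theorem seminorm_tensorFin_zero_le (f : Fin 0 → 𝓢(E, ℂ)) {R : ℝ} (hR : 1 ≤ R) (k l : ℕ) :
    SchwartzMap.seminorm ℝ k l (SchwartzMap.tensorFin 0 f) ≤ R ^ k * ((0 : ℕ) * 0 : ℝ) ^ l := by
  refine SchwartzMap.seminorm_le_bound ℝ k l _ (by positivity) fun x => ?_
  have hx : ‖x‖ = 0 := by rw [Subsingleton.elim x 0, norm_zero]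
  have hfun : (SchwartzMap.tensorFin 0 f : (Fin 0 → E) → ℂ) = fun _ => (1 : ℂ) := by
    funext y; simp [SchwartzMap.tensorFin_apply]
  rw [hfun]
  rcases Nat.eq_zero_or_pos l with h0 | hpos
  · rw [h0, norm_iteratedFDeriv_zero, norm_one, mul_one, pow_zero, mul_one]
    rcases Nat.eq_zero_or_pos k with h1 | h1
    · rw [h1, pow_zero, pow_zero]
    · rw [hx, zero_pow h1.ne']; positivity
  · rw [iteratedFDeriv_const_of_ne hpos.ne']
    simp only [Pi.zero_apply, norm_zero, mul_zero]
    positivity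

/-- **Schwartz seminorms of tensor products, geometric form.** If `p_{k,i}(fⱼ) ≤ aⱼ Rᵏ Bⁱ` for all
`k, i ≤ M` (`R ≥ 1`, `B ≥ 0`, `aⱼ ≥ 0`), then for `k, l ≤ M`,
`p_{k,l}(⊗_{j<n} fⱼ) ≤ 2ⁿ (∏ⱼ aⱼ) Rᵏ (nB)ˡ`: the total order `l` is distributed over the factors. [cite: OsterwalderSchraderCMP1975, Ch. VI.1 (6.17)–(6.18)] -/
theorem seminorm_tensorFin_le_geometric {n : ℕ} (f : Fin n → 𝓢(E, ℂ)) {M : ℕ} {R B : ℝ} (hR : 1 ≤ R) (hB : 0 ≤ B)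
    (a : Fin n → ℝ) (ha : ∀ j, 0 ≤ a j)
    (hf : ∀ j, ∀ k ≤ M, ∀ i ≤ M, SchwartzMap.seminorm ℝ k i (f j) ≤ a j * R ^ k * B ^ i) :
    ∀ k ≤ M, ∀ l ≤ M, SchwartzMap.seminorm ℝ k l (SchwartzMap.tensorFin n f) ≤ 2 ^ n * (∏ j, a j) * R ^ k * (n * B) ^ l := by
  induction n with
  | zero =>
    intro k _ l _
    have h := seminorm_tensorFin_zero_le f hR k l
    simpa using h
  | succ n ih =>
    intro k hk l hl
    -- the recursion through `mulCompBound`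
    have hrec := seminorm_tensorFin_succ_le_mulCompBound f k l
    rw [← seminorm_real_eq] at hrec
    refine hrec.trans ?_
    set F := SchwartzMap.tensorFin n fun i => f i.castSucc with hF
    set g := f (Fin.last n) with hg
    set P : ℝ := ∏ j : Fin n, a j.castSucc with hP
    have hP0 : 0 ≤ P := Finset.prod_nonneg fun j _ => ha _
    have hIH := ih (fun i => f i.castSucc) (fun j => a j.castSucc) (fun j => ha _) (fun j => hf _)
    have halast : 0 ≤ a (Fin.last n) := ha _
    have hπ₁ := norm_restrictCLM_le_one (E := E) (Fin.castSucc : Fin n → Fin (n + 1))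
    have hπ₂ := norm_proj_le_one (E := E) (Fin.last n)
    unfold SchwartzMap.mulCompBound
    rw [abs_one, one_pow, one_mul]
    -- termwise bound
    have hterm : ∀ i ∈ Finset.range (l + 1),
        (l.choose i : ℝ) * (‖SchwartzMap.restrictCLM (E := E) (Fin.castSucc : Fin n → Fin (n + 1))‖ ^ i *
          ‖(ContinuousLinearMap.proj (R := ℝ) (φ := fun _ : Fin (n + 1) => E) (Fin.last n))‖ ^ (l - i)) *
        (SchwartzMap.seminorm ℝ k i F * SchwartzMap.seminorm ℝ 0 (l - i) g +
          SchwartzMap.seminorm ℝ 0 i F * SchwartzMap.seminorm ℝ k (l - i) g) ≤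
        (l.choose i : ℝ) * (n : ℝ) ^ i * (2 * (2 ^ n * P * a (Fin.last n) * R ^ k * B ^ l)) := by
      intro i hi
      rw [Finset.mem_range] at hi
      have hil : i ≤ l := Nat.lt_succ_iff.1 hi
      have hiM : i ≤ M := hil.trans hl
      have hliM : l - i ≤ M := (Nat.sub_le l i).trans hl
      have hπ : ‖SchwartzMap.restrictCLM (E := E) (Fin.castSucc : Fin n → Fin (n + 1))‖ ^ i *
          ‖(ContinuousLinearMap.proj (R := ℝ) (φ := fun _ : Fin (n + 1) => E) (Fin.last n))‖ ^ (l - i) ≤ 1 :=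
        mul_le_one₀ (pow_le_one₀ (norm_nonneg _) hπ₁) (by positivity) (pow_le_one₀ (norm_nonneg _) hπ₂)
      have e1 : SchwartzMap.seminorm ℝ k i F ≤ 2 ^ n * P * R ^ k * (n * B) ^ i := hIH k hk i hiM
      have e2 : SchwartzMap.seminorm ℝ 0 (l - i) g ≤ a (Fin.last n) * R ^ 0 * B ^ (l - i) := hf _ 0 (Nat.zero_le _) _ hliM
      have e3 : SchwartzMap.seminorm ℝ 0 i F ≤ 2 ^ n * P * R ^ 0 * (n * B) ^ i := hIH 0 (Nat.zero_le _) i hiM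
      have e4 : SchwartzMap.seminorm ℝ k (l - i) g ≤ a (Fin.last n) * R ^ k * B ^ (l - i) := hf _ k hk _ hliM
      have hprod1 := mul_le_mul e1 e2 (apply_nonneg _ _) (by positivity)
      have hprod2 := mul_le_mul e3 e4 (apply_nonneg _ _) (by positivity)
      have hBpow : (n * B) ^ i * B ^ (l - i) = (n : ℝ) ^ i * B ^ l := by
        rw [mul_pow, mul_assoc, ← pow_add, Nat.add_sub_cancel' hil]
      have hsum : SchwartzMap.seminorm ℝ k i F * SchwartzMap.seminorm ℝ 0 (l - i) g +
          SchwartzMap.seminorm ℝ 0 i F * SchwartzMap.seminorm ℝ k (l - i) g ≤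
          (n : ℝ) ^ i * (2 * (2 ^ n * P * a (Fin.last n) * R ^ k * B ^ l)) := by
        calc _ ≤ 2 ^ n * P * R ^ k * (n * B) ^ i * (a (Fin.last n) * R ^ 0 * B ^ (l - i)) +
              2 ^ n * P * R ^ 0 * (n * B) ^ i * (a (Fin.last n) * R ^ k * B ^ (l - i)) := add_le_add hprod1 hprod2
          _ = (n : ℝ) ^ i * (2 * (2 ^ n * P * a (Fin.last n) * R ^ k * B ^ l)) := by
              rw [pow_zero, mul_one, mul_one]
              have : (2 : ℝ) ^ n * P * R ^ k * (↑n * B) ^ i * (a (Fin.last n) * B ^ (l - i)) =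
                  2 ^ n * P * a (Fin.last n) * R ^ k * ((↑n * B) ^ i * B ^ (l - i)) := by ring
              rw [this, hBpow]
              have : (2 : ℝ) ^ n * P * (↑n * B) ^ i * (a (Fin.last n) * R ^ k * B ^ (l - i)) =
                  2 ^ n * P * a (Fin.last n) * R ^ k * ((↑n * B) ^ i * B ^ (l - i)) := by ring
              rw [this, hBpow]
              ring
      calc _ ≤ (l.choose i : ℝ) * 1 * ((n : ℝ) ^ i * (2 * (2 ^ n * P * a (Fin.last n) * R ^ k * B ^ l))) := by
            gcongr
        _ = _ := by ring
    refine (Finset.sum_le_sum hterm).trans (le_of_eq ?_)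
    have hs : ∑ i ∈ Finset.range (l + 1), (l.choose i : ℝ) * (n : ℝ) ^ i * (2 * (2 ^ n * P * a (Fin.last n) * R ^ k * B ^ l)) =
        (∑ i ∈ Finset.range (l + 1), (l.choose i : ℝ) * (n : ℝ) ^ i) * (2 * (2 ^ n * P * a (Fin.last n) * R ^ k * B ^ l)) := by
      rw [Finset.sum_mul]
    rw [hs, sum_choose_mul_pow, Fin.prod_univ_castSucc, ← hP]
    push_cast
    rw [mul_pow]
    ring

/-- **Schwartz norms of tensor products, geometric form**: under the same hypotheses,
`|⊗_{j<n} fⱼ|_M ≤ 2ⁿ (∏ⱼ aⱼ) Rᴹ max(1, nB)ᴹ`. [cite: OsterwalderSchraderCMP1975, Ch. VI.1 (6.17)–(6.18)] -/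
theorem schwartzNorm_tensorFin_le_geometric {n : ℕ} (f : Fin n → 𝓢(E, ℂ)) {M : ℕ} {R B : ℝ} (hR : 1 ≤ R) (hB : 0 ≤ B)
    (a : Fin n → ℝ) (ha : ∀ j, 0 ≤ a j)
    (hf : ∀ j, ∀ k ≤ M, ∀ i ≤ M, SchwartzMap.seminorm ℝ k i (f j) ≤ a j * R ^ k * B ^ i) :
    schwartzNorm M (SchwartzMap.tensorFin n f) ≤ 2 ^ n * (∏ j, a j) * R ^ M * max 1 (n * B) ^ M := by
  have hP0 : 0 ≤ ∏ j, a j := Finset.prod_nonneg fun j _ => ha j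
  change ((Finset.Iic (M, M)).sup (schwartzSeminormFamily ℂ _ ℂ)) (SchwartzMap.tensorFin n f) ≤ _
  refine Seminorm.finset_sup_apply_le (by positivity) fun q hq => ?_
  rw [Finset.mem_Iic] at hq
  rw [SchwartzMap.schwartzSeminormFamily_apply, ← seminorm_real_eq]
  refine (seminorm_tensorFin_le_geometric f hR hB a ha hf q.1 hq.1 q.2 hq.2).trans ?_
  have h1 : R ^ q.1 ≤ R ^ M := pow_le_pow_right₀ hR hq.1
  have h2 : ((n : ℝ) * B) ^ q.2 ≤ max 1 ((n : ℝ) * B) ^ M :=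
    (pow_le_pow_left₀ (by positivity) (le_max_right _ _) _).trans (pow_le_pow_right₀ (le_max_left _ _) hq.2)
  exact mul_le_mul (mul_le_mul_of_nonneg_left h1 (by positivity)) h2 (by positivity) (by positivity)

end Literature.MathematicalPhysics.QuantumFieldTheory
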